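import Mathlib
import HarnessLib
import Literature.MathematicalPhysics.StatisticalMechanics.RenormalisationMapLipschitzQ

/-!
# `S_k` for TWO STEP KERNELS: the glue from the nine piece bounds to `nextKStep D_a H K − nextKStep D_b H K`
# ([ABKM19] Theorem 6.8 (6.59)–(6.60); hypothesis (12.53) of Lemma 12.6, assembly step)

For the same `(H, K)` and two step data `D, Db` of scale `k` (sharing `s, L`) the decomposition
`S(H,K)(U) = blockPart + Σ₁ + Σ₂ᴸ + Σ₃ + Σ₄` (`nextKStep_eq_blockPart_add_remainders_abkm_of_stepKernelBounds`, with the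
extracted Hamiltonians `H̃_a = nextH D H K`, `H̃_b = nextH Db H K`) gives
`S_a − S_b = Δ(blockPart) + Σᵢ ([Σᵢ(D; H̃_a) − Σᵢ(D; H̃_b)] + [Σᵢ(D; H̃_b) − Σᵢ(Db; H̃_b)])` — one linear piece and, for each of
the four remainders, a one-kernel `H̃`-variation bracket (RemaindersOneQ / RemaindersTwoQ with `H' = H`, `K' = K`) and a
kernel-only bracket (`…KernelOnly` files of the line `banach_two_kernel`).  This file is the pure glue: given `TayNormLE`
bounds `c₀, …, c₈` for the nine pieces (arbitrary real constants), the difference of the two images is bounded by their sum.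
The `C^{r₀}` bookkeeping of the nine functionals is discharged here from the torus data.

* **`tayNormLE_nextKStep_kernel_sub_of_pieces`**.

Use (honest scope): assembly step of stub 1 of the line `banach_two_kernel` of the child `TwoKernelSkBound` of the cruxes
`HypACumulant` / `HypALocalTwoPoint` of the rung route `Summits/HubbardSuperconductivity/…/Theses/ComplexGFFStiffness`; nothing
about superconductivity in the Hubbard model.  Everything is proved; no named fact.

## References
* S. Adams, S. Buchholz, R. Kotecký, S. Müller, arXiv:1910.13564, Theorem 6.8 ((6.59)–(6.60)), Lemma 9.6, Ch. 10.1,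
  Lemma 12.6 (12.53) [AdamsBuchholzKoteckyMuller2019].
-/

noncomputable section

namespace Literature.MathematicalPhysics.StatisticalMechanics.GradientRG

open scoped BigOperators Classical
open Finset MeasureTheory
open Literature.MathematicalPhysics.StatisticalMechanics.TorusPolymer
  (IsPolymer blocks polys bprod blockOf thicken reblock boxCorner mem_polys mem_blocks numBlocks isPolymer_blockOf
    card_blocks_eq_numBlocks blocks_blockOf empty_mem_polys closure mem_blockOf_self)
open Literature.Barriers.CriticalPhenomena.LongRangePhi4.Polymer (IsConn components)
open Literature.MathematicalPhysics.StatisticalMechanics.GradientFRD (iterDiff)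
open Literature.MathematicalPhysics.QuantumFieldTheory

variable {d M : ℕ} [NeZero M]

set_option maxHeartbeats 800000 in
/-- **Glue for the two-kernel comparison of `S_k`** (module docstring): torus data at scale `k` (`d ≥ 2`, `L` odd,
`L ≥ 2^{d+3}+16R`, `M = L^N`, `k+1 ≤ N`, `p ≤ R`, `⌊d/2⌋+1 ≤ min(p, M_ord)`, weights of Theorem 7.1, `A > 0`), two step data `D, Db`
with `D.s = Db.s = L^k`, `D.L = Db.L = L`, `StepKernelBounds` for both kernels, reference blocks `B_{x₀}`, `B_{x₀'}` with their box
corners; `‖H‖_{k,0} ≤ 1/8`; `K` factorising, `K(∅) = 1`, `C^{r₀}`, local, `‖K‖_k ≤ C`; `U` non-empty.  If the nine pieces of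
`S_a(H,K)(U) − S_b(H,K)(U)` are bounded in `|·|_{T_{k+1}^{U*}, w_{k+1}^U}` by `c₀, …, c₈`, then the difference is bounded by
`c₀ + c₁ + … + c₈`. [cite: AdamsBuchholzKoteckyMuller2019, Theorem 6.8 (6.59)–(6.60) / Lemma 12.6 (12.53)] -/
theorem tayNormLE_nextKStep_kernel_sub_of_pieces {L N Mord R n p r₀ : ℕ}
    {θbar lam μ δ₁ δ₀ A𝒫 A𝒫a A𝒫b C₂a C₂b h A : ℝ}
    {𝒞 : ℕ → (Fin d → ZMod M) → ℝ} (hd : 2 ≤ d) (hLodd : Odd L) (hL : 2 ^ (d + 3) + 16 * R ≤ L)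
    (hM : M = L ^ N) {k : ℕ} (hkN : k + 1 ≤ N) (hp : d / 2 + 1 ≤ p) (hpR : p ≤ R) (hMord : d / 2 + 1 ≤ Mord)
    (hB : AbkmWeightBounds L N Mord R n θbar lam μ δ₁ δ₀ A𝒫 𝒞
      (abkmWeightData L N Mord R θbar (schedDelta δ₀ δ₁ N) 𝒞))
    (hδ₀ : 0 < δ₀) (hδ₁ : 0 < δ₁) (hh : 0 < h) (hh0 : hZeroSq d R δ₀ δ₁ ≤ h ^ 2) (hA : 0 < A)
    (D Db : StepData d M) (hDs : D.s = L ^ k) (hDL : D.L = L) (hDbs : Db.s = L ^ k) (hDbL : Db.L = L)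
    (hS : StepKernelBounds (abkmWeightData L N Mord R θbar (schedDelta δ₀ δ₁ N) 𝒞) L k A𝒫a C₂a D.𝒞)
    (hSb : StepKernelBounds (abkmWeightData L N Mord R θbar (schedDelta δ₀ δ₁ N) 𝒞) L k A𝒫b C₂b Db.𝒞)
    {x₀ x₀' : Fin d → ZMod M} (hB₀ : D.B₀ = blockOf (L ^ k) x₀) (hc₀ : D.c₀ = boxCorner (L ^ k) (starRad R L d k) x₀)
    (hB₀b : Db.B₀ = blockOf (L ^ k) x₀') (hc₀b : Db.c₀ = boxCorner (L ^ k) (starRad R L d k) x₀')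
    {H : RelevantHamiltonian ℂ d}
    (hH : hamNorm (fieldWt h (L : ℝ) d k) ((L : ℝ) ^ k) (L ^ (d * k)) H ≤ 1 / 8)
    {K : Finset (Fin d → ZMod M) → ((Fin d → ZMod M) → ℝ) → ℂ} {C : ℝ} (hC : 0 ≤ C)
    (hK : WeakNormLE (abkmNormParams L N Mord R p r₀ h θbar A (schedDelta δ₀ δ₁ N) 𝒞) k K C)
    (hKfac : Factorises (L ^ k) K) (hK0 : ∀ φ, K ∅ φ = 1) (hKd : ∀ Y, ContDiff ℝ r₀ (K Y))
    (hKloc : ∀ Y, IsPolymer (L ^ k) Y → IsConn Y →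
      IsGaugeLocal ((abkmNormParams L N Mord R p r₀ h θbar A (schedDelta δ₀ δ₁ N) 𝒞).gauge k Y) (K Y))
    {U : Finset (Fin d → ZMod M)} (hUne : U.Nonempty)
    {c₀ c₁ c₂ c₃ c₄ c₅ c₆ c₇ c₈ : ℝ}
    (h0 : TayNormLE ((abkmNormParams L N Mord R p r₀ h θbar A (schedDelta δ₀ δ₁ N) 𝒞).gauge (k + 1) U) r₀
      ((abkmWeightData L N Mord R θbar (schedDelta δ₀ δ₁ N) 𝒞).weight (k + 1) U)
      (fun φ => blockPart D K U φ - blockPart Db K U φ) c₀)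
    (h1a : TayNormLE ((abkmNormParams L N Mord R p r₀ h θbar A (schedDelta δ₀ δ₁ N) 𝒞).gauge (k + 1) U) r₀
      ((abkmWeightData L N Mord R θbar (schedDelta δ₀ δ₁ N) 𝒞).weight (k + 1) U)
      (fun φ => (∑ B ∈ blockPartIndex D U,
        ((bprod (L ^ k) (fun B' => expNegH (nextH D H K) B' φ) (U \ B) *
              bprod (L ^ k) (fun B' => expNegH (-(nextH D H K)) B' φ) (B \ U) - 1) * blockTerm D K B φ +
          bprod (L ^ k) (fun B' => expNegH (nextH D H K) B' φ) (U \ B) *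
              bprod (L ^ k) (fun B' => expNegH (-(nextH D H K)) B' φ) (B \ U) *
            (fluctDefect D.𝒞 H B φ +
              (expNegH (stepOpA (gradCov D.𝒞) H) B φ - 1) * (1 - Complex.exp (-(eval (opB D K) B φ))) -
              (Complex.exp (-(eval (opB D K) B φ)) - 1 + eval (opB D K) B φ)) +
          bprod (L ^ k) (fun B' => expNegH (nextH D H K) B' φ) (U \ B) *
              bprod (L ^ k) (fun B' => expNegH (-(nextH D H K)) B' φ) (B \ U) *
            fluct D.𝒞 (fun ψ => ∑ Y ∈ ((polys (L ^ k) B).erase B).erase ∅,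
              bprod (L ^ k) (fun B' => expNegH H B' ψ - 1) (B \ Y) * K Y ψ) φ)) -
        (∑ B ∈ blockPartIndex D U,
        ((bprod (L ^ k) (fun B' => expNegH (nextH Db H K) B' φ) (U \ B) *
              bprod (L ^ k) (fun B' => expNegH (-(nextH Db H K)) B' φ) (B \ U) - 1) * blockTerm D K B φ +
          bprod (L ^ k) (fun B' => expNegH (nextH Db H K) B' φ) (U \ B) *
              bprod (L ^ k) (fun B' => expNegH (-(nextH Db H K)) B' φ) (B \ U) *
            (fluctDefect D.𝒞 H B φ +
              (expNegH (stepOpA (gradCov D.𝒞) H) B φ - 1) * (1 - Complex.exp (-(eval (opB D K) B φ))) -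
              (Complex.exp (-(eval (opB D K) B φ)) - 1 + eval (opB D K) B φ)) +
          bprod (L ^ k) (fun B' => expNegH (nextH Db H K) B' φ) (U \ B) *
              bprod (L ^ k) (fun B' => expNegH (-(nextH Db H K)) B' φ) (B \ U) *
            fluct D.𝒞 (fun ψ => ∑ Y ∈ ((polys (L ^ k) B).erase B).erase ∅,
              bprod (L ^ k) (fun B' => expNegH H B' ψ - 1) (B \ Y) * K Y ψ) φ))) c₁)
    (h1b : TayNormLE ((abkmNormParams L N Mord R p r₀ h θbar A (schedDelta δ₀ δ₁ N) 𝒞).gauge (k + 1) U) r₀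
      ((abkmWeightData L N Mord R θbar (schedDelta δ₀ δ₁ N) 𝒞).weight (k + 1) U)
      (fun φ => (∑ B ∈ blockPartIndex D U,
        ((bprod (L ^ k) (fun B' => expNegH (nextH Db H K) B' φ) (U \ B) *
              bprod (L ^ k) (fun B' => expNegH (-(nextH Db H K)) B' φ) (B \ U) - 1) * blockTerm D K B φ +
          bprod (L ^ k) (fun B' => expNegH (nextH Db H K) B' φ) (U \ B) *
              bprod (L ^ k) (fun B' => expNegH (-(nextH Db H K)) B' φ) (B \ U) *
            (fluctDefect D.𝒞 H B φ +
              (expNegH (stepOpA (gradCov D.𝒞) H) B φ - 1) * (1 - Complex.exp (-(eval (opB D K) B φ))) -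
              (Complex.exp (-(eval (opB D K) B φ)) - 1 + eval (opB D K) B φ)) +
          bprod (L ^ k) (fun B' => expNegH (nextH Db H K) B' φ) (U \ B) *
              bprod (L ^ k) (fun B' => expNegH (-(nextH Db H K)) B' φ) (B \ U) *
            fluct D.𝒞 (fun ψ => ∑ Y ∈ ((polys (L ^ k) B).erase B).erase ∅,
              bprod (L ^ k) (fun B' => expNegH H B' ψ - 1) (B \ Y) * K Y ψ) φ)) -
        (∑ B ∈ blockPartIndex D U,
        ((bprod (L ^ k) (fun B' => expNegH (nextH Db H K) B' φ) (U \ B) *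
              bprod (L ^ k) (fun B' => expNegH (-(nextH Db H K)) B' φ) (B \ U) - 1) * blockTerm Db K B φ +
          bprod (L ^ k) (fun B' => expNegH (nextH Db H K) B' φ) (U \ B) *
              bprod (L ^ k) (fun B' => expNegH (-(nextH Db H K)) B' φ) (B \ U) *
            (fluctDefect Db.𝒞 H B φ +
              (expNegH (stepOpA (gradCov Db.𝒞) H) B φ - 1) * (1 - Complex.exp (-(eval (opB Db K) B φ))) -
              (Complex.exp (-(eval (opB Db K) B φ)) - 1 + eval (opB Db K) B φ)) +
          bprod (L ^ k) (fun B' => expNegH (nextH Db H K) B' φ) (U \ B) *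
              bprod (L ^ k) (fun B' => expNegH (-(nextH Db H K)) B' φ) (B \ U) *
            fluct Db.𝒞 (fun ψ => ∑ Y ∈ ((polys (L ^ k) B).erase B).erase ∅,
              bprod (L ^ k) (fun B' => expNegH H B' ψ - 1) (B \ Y) * K Y ψ) φ))) c₂)
    (h2a : TayNormLE ((abkmNormParams L N Mord R p r₀ h θbar A (schedDelta δ₀ δ₁ N) 𝒞).gauge (k + 1) U) r₀
      ((abkmWeightData L N Mord R θbar (schedDelta δ₀ δ₁ N) 𝒞).weight (k + 1) U)
      (fun φ => ∑ X ∈ largePartIndex (L ^ k) L U,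
        ((bprod (L ^ k) (fun B => expNegH (nextH D H K) B φ) (U \ X) * bprod (L ^ k) (fun B => expNegH (-(nextH D H K)) B φ) (X \ U) *
            (fluct D.𝒞 (polyP2 (L ^ k) H K X) φ + bprod (L ^ k) (fun B => 1 - expNegH (nextH D H K) B φ) X)) -
          (bprod (L ^ k) (fun B => expNegH (nextH Db H K) B φ) (U \ X) * bprod (L ^ k) (fun B => expNegH (-(nextH Db H K)) B φ) (X \ U) *
            (fluct D.𝒞 (polyP2 (L ^ k) H K X) φ + bprod (L ^ k) (fun B => 1 - expNegH (nextH Db H K) B φ) X)))) c₃)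
    (h2b : TayNormLE ((abkmNormParams L N Mord R p r₀ h θbar A (schedDelta δ₀ δ₁ N) 𝒞).gauge (k + 1) U) r₀
      ((abkmWeightData L N Mord R θbar (schedDelta δ₀ δ₁ N) 𝒞).weight (k + 1) U)
      (fun φ => ∑ X ∈ largePartIndex (L ^ k) L U,
        ((bprod (L ^ k) (fun B => expNegH (nextH Db H K) B φ) (U \ X) * bprod (L ^ k) (fun B => expNegH (-(nextH Db H K)) B φ) (X \ U) *
            (fluct D.𝒞 (polyP2 (L ^ k) H K X) φ + bprod (L ^ k) (fun B => 1 - expNegH (nextH Db H K) B φ) X)) -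
          (bprod (L ^ k) (fun B => expNegH (nextH Db H K) B φ) (U \ X) * bprod (L ^ k) (fun B => expNegH (-(nextH Db H K)) B φ) (X \ U) *
            (fluct Db.𝒞 (polyP2 (L ^ k) H K X) φ + bprod (L ^ k) (fun B => 1 - expNegH (nextH Db H K) B φ) X)))) c₄)
    (h3a : TayNormLE ((abkmNormParams L N Mord R p r₀ h θbar A (schedDelta δ₀ δ₁ N) 𝒞).gauge (k + 1) U) r₀
      ((abkmWeightData L N Mord R θbar (schedDelta δ₀ δ₁ N) 𝒞).weight (k + 1) U)
      (fun φ => ∑ X ∈ ((polys (L ^ k) univ).filter (fun X => reblock (L ^ k) (L * L ^ k) X = U)).filter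
          (fun X => ¬ IsConn X),
        ((bprod (L ^ k) (fun B => expNegH (nextH D H K) B φ) (U \ X) * bprod (L ^ k) (fun B => expNegH (-(nextH D H K)) B φ) (X \ U) *
            (fluct D.𝒞 (polyP2 (L ^ k) H K X) φ + bprod (L ^ k) (fun B => 1 - expNegH (nextH D H K) B φ) X)) -
          (bprod (L ^ k) (fun B => expNegH (nextH Db H K) B φ) (U \ X) * bprod (L ^ k) (fun B => expNegH (-(nextH Db H K)) B φ) (X \ U) *
            (fluct D.𝒞 (polyP2 (L ^ k) H K X) φ + bprod (L ^ k) (fun B => 1 - expNegH (nextH Db H K) B φ) X)))) c₅)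
    (h3b : TayNormLE ((abkmNormParams L N Mord R p r₀ h θbar A (schedDelta δ₀ δ₁ N) 𝒞).gauge (k + 1) U) r₀
      ((abkmWeightData L N Mord R θbar (schedDelta δ₀ δ₁ N) 𝒞).weight (k + 1) U)
      (fun φ => ∑ X ∈ ((polys (L ^ k) univ).filter (fun X => reblock (L ^ k) (L * L ^ k) X = U)).filter
          (fun X => ¬ IsConn X),
        ((bprod (L ^ k) (fun B => expNegH (nextH Db H K) B φ) (U \ X) * bprod (L ^ k) (fun B => expNegH (-(nextH Db H K)) B φ) (X \ U) *
            (fluct D.𝒞 (polyP2 (L ^ k) H K X) φ + bprod (L ^ k) (fun B => 1 - expNegH (nextH Db H K) B φ) X)) -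
          (bprod (L ^ k) (fun B => expNegH (nextH Db H K) B φ) (U \ X) * bprod (L ^ k) (fun B => expNegH (-(nextH Db H K)) B φ) (X \ U) *
            (fluct Db.𝒞 (polyP2 (L ^ k) H K X) φ + bprod (L ^ k) (fun B => 1 - expNegH (nextH Db H K) B φ) X)))) c₆)
    (h4a : TayNormLE ((abkmNormParams L N Mord R p r₀ h θbar A (schedDelta δ₀ δ₁ N) 𝒞).gauge (k + 1) U) r₀
      ((abkmWeightData L N Mord R θbar (schedDelta δ₀ δ₁ N) 𝒞).weight (k + 1) U)
      (fun φ => ∑ X ∈ (polys (L ^ k) univ).filter (fun X => reblock (L ^ k) (L * L ^ k) X = U),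
        ∑ X₁ ∈ ((polys (L ^ k) X).erase X).erase ∅,
        ((bprod (L ^ k) (fun B => expNegH (nextH D H K) B φ) (U \ X) * bprod (L ^ k) (fun B => expNegH (-(nextH D H K)) B φ) (X \ U) *
            (bprod (L ^ k) (fun B => 1 - expNegH (nextH D H K) B φ) X₁ * fluct D.𝒞 (polyP2 (L ^ k) H K (X \ X₁)) φ)) -
          (bprod (L ^ k) (fun B => expNegH (nextH Db H K) B φ) (U \ X) * bprod (L ^ k) (fun B => expNegH (-(nextH Db H K)) B φ) (X \ U) *
            (bprod (L ^ k) (fun B => 1 - expNegH (nextH Db H K) B φ) X₁ * fluct D.𝒞 (polyP2 (L ^ k) H K (X \ X₁)) φ)))) c₇)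
    (h4b : TayNormLE ((abkmNormParams L N Mord R p r₀ h θbar A (schedDelta δ₀ δ₁ N) 𝒞).gauge (k + 1) U) r₀
      ((abkmWeightData L N Mord R θbar (schedDelta δ₀ δ₁ N) 𝒞).weight (k + 1) U)
      (fun φ => ∑ X ∈ (polys (L ^ k) univ).filter (fun X => reblock (L ^ k) (L * L ^ k) X = U),
        ∑ X₁ ∈ ((polys (L ^ k) X).erase X).erase ∅,
        ((bprod (L ^ k) (fun B => expNegH (nextH Db H K) B φ) (U \ X) * bprod (L ^ k) (fun B => expNegH (-(nextH Db H K)) B φ) (X \ U) *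
            (bprod (L ^ k) (fun B => 1 - expNegH (nextH Db H K) B φ) X₁ * fluct D.𝒞 (polyP2 (L ^ k) H K (X \ X₁)) φ)) -
          (bprod (L ^ k) (fun B => expNegH (nextH Db H K) B φ) (U \ X) * bprod (L ^ k) (fun B => expNegH (-(nextH Db H K)) B φ) (X \ U) *
            (bprod (L ^ k) (fun B => 1 - expNegH (nextH Db H K) B φ) X₁ * fluct Db.𝒞 (polyP2 (L ^ k) H K (X \ X₁)) φ)))) c₈) :
    TayNormLE ((abkmNormParams L N Mord R p r₀ h θbar A (schedDelta δ₀ δ₁ N) 𝒞).gauge (k + 1) U) r₀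
      ((abkmWeightData L N Mord R θbar (schedDelta δ₀ δ₁ N) 𝒞).weight (k + 1) U)
      (fun φ => nextKStep D H K U φ - nextKStep Db H K U φ)
      (c₀ + c₁ + c₂ + c₃ + c₄ + c₅ + c₆ + c₇ + c₈) := by
  have hk1 : k + 1 ≤ N + 1 := by omega
  have hMo : Odd M := by rw [hM]; exact hLodd.pow
  have hsodd : Odd (L ^ k) := hLodd.pow
  -- smoothness of the single-data functionals
  have hUk : ∀ X ∈ ((polys (L ^ k) univ).filter (fun X => reblock (L ^ k) (L * L ^ k) X = U)), IsPolymer (L ^ k) X :=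
    fun X hX => (mem_polys.1 (mem_filter.1 hX).1).2
  have hF0d : ContDiff ℝ r₀ (fun φ => blockPart D K U φ - blockPart Db K U φ) :=
    (contDiff_blockPart_abkm_of_stepKernelBounds hB hLodd hM hA D hDs hS hC hK hKd hKloc U).sub
      (contDiff_blockPart_abkm_of_stepKernelBounds hB hLodd hM hA Db hDbs hSb hC hK hKd hKloc U)
  have hblk : ∀ B ∈ blockPartIndex D U, ∃ y, B = blockOf (L ^ k) y := fun B hB' => by
    have hBb := blockPartIndex_subset_blocks D U hB'
    rw [hDs] at hBb
    obtain ⟨y, -, rfl⟩ := mem_blocks.1 hBb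
    exact ⟨y, rfl⟩
  have hS1d : ∀ (Dq : StepData d M) {A𝒫q C₂q : ℝ},
      StepKernelBounds (abkmWeightData L N Mord R θbar (schedDelta δ₀ δ₁ N) 𝒞) L k A𝒫q C₂q Dq.𝒞 →
      ∀ (Ht : RelevantHamiltonian ℂ d), ContDiff ℝ r₀ (fun φ : (Fin d → ZMod M) → ℝ => (∑ B ∈ blockPartIndex D U,
        ((bprod (L ^ k) (fun B' => expNegH (Ht) B' φ) (U \ B) *
              bprod (L ^ k) (fun B' => expNegH (-(Ht)) B' φ) (B \ U) - 1) * blockTerm Dq K B φ +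
          bprod (L ^ k) (fun B' => expNegH (Ht) B' φ) (U \ B) *
              bprod (L ^ k) (fun B' => expNegH (-(Ht)) B' φ) (B \ U) *
            (fluctDefect Dq.𝒞 H B φ +
              (expNegH (stepOpA (gradCov Dq.𝒞) H) B φ - 1) * (1 - Complex.exp (-(eval (opB Dq K) B φ))) -
              (Complex.exp (-(eval (opB Dq K) B φ)) - 1 + eval (opB Dq K) B φ)) +
          bprod (L ^ k) (fun B' => expNegH (Ht) B' φ) (U \ B) *
              bprod (L ^ k) (fun B' => expNegH (-(Ht)) B' φ) (B \ U) *
            fluct Dq.𝒞 (fun ψ => ∑ Y ∈ ((polys (L ^ k) B).erase B).erase ∅,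
              bprod (L ^ k) (fun B' => expNegH H B' ψ - 1) (B \ Y) * K Y ψ) φ))) := by
    intro Dq A𝒫q C₂q hSq Ht
    refine ContDiff.sum fun B hB' => ?_
    obtain ⟨y, rfl⟩ := hblk B hB'
    exact contDiff_blockSummand_abkm_of_stepKernelBounds (p := p) (r₀ := r₀) (A := A) hd hB hLodd hM hkN hδ₀ hδ₁ hh hh0 hMord hp
      hA Dq hSq y Ht hH hC hK hKd hKloc U
  have hT2d : ∀ (𝒞q : (Fin d → ZMod M) → ℝ) {A𝒫q C₂q : ℝ},
      StepKernelBounds (abkmWeightData L N Mord R θbar (schedDelta δ₀ δ₁ N) 𝒞) L k A𝒫q C₂q 𝒞q →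
      ∀ (Ht : RelevantHamiltonian ℂ d) (X : Finset (Fin d → ZMod M)), IsPolymer (L ^ k) X →
      ContDiff ℝ r₀ (fun φ : (Fin d → ZMod M) → ℝ =>
        bprod (L ^ k) (fun B => expNegH (Ht) B φ) (U \ X) * bprod (L ^ k) (fun B => expNegH (-(Ht)) B φ) (X \ U) *
            (fluct 𝒞q (polyP2 (L ^ k) H K X) φ + bprod (L ^ k) (fun B => 1 - expNegH (Ht) B φ) X)) :=
    fun 𝒞q A𝒫q C₂q hSq Ht X hXp =>
      contDiff_reblockTop_abkm_of_stepKernelBounds hd hLodd hM hkN hSq hp hMord hB hδ₀ hδ₁ hh hh0 hA hXp Ht hH hC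
        hK hKfac hK0 hKd hKloc U
  have hT4d : ∀ (𝒞q : (Fin d → ZMod M) → ℝ) {A𝒫q C₂q : ℝ},
      StepKernelBounds (abkmWeightData L N Mord R θbar (schedDelta δ₀ δ₁ N) 𝒞) L k A𝒫q C₂q 𝒞q →
      ∀ (Ht : RelevantHamiltonian ℂ d) (X : Finset (Fin d → ZMod M)), IsPolymer (L ^ k) X →
      ∀ X₁ ∈ polys (L ^ k) X,
      ContDiff ℝ r₀ (fun φ : (Fin d → ZMod M) → ℝ =>
        bprod (L ^ k) (fun B => expNegH (Ht) B φ) (U \ X) * bprod (L ^ k) (fun B => expNegH (-(Ht)) B φ) (X \ U) *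
            (bprod (L ^ k) (fun B => 1 - expNegH (Ht) B φ) X₁ * fluct 𝒞q (polyP2 (L ^ k) H K (X \ X₁)) φ)) :=
    fun 𝒞q A𝒫q C₂q hSq Ht X hXp X₁ hX₁ =>
      contDiff_reblockSub_abkm_of_stepKernelBounds hd hLodd hM hkN hSq hp hMord hB hδ₀ hδ₁ hh hh0 hA hXp hX₁ Ht hH
        hC hK hKfac hK0 hKd hKloc U
  have hF1ad : ContDiff ℝ r₀ (fun φ => (∑ B ∈ blockPartIndex D U,
        ((bprod (L ^ k) (fun B' => expNegH (nextH D H K) B' φ) (U \ B) *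
              bprod (L ^ k) (fun B' => expNegH (-(nextH D H K)) B' φ) (B \ U) - 1) * blockTerm D K B φ +
          bprod (L ^ k) (fun B' => expNegH (nextH D H K) B' φ) (U \ B) *
              bprod (L ^ k) (fun B' => expNegH (-(nextH D H K)) B' φ) (B \ U) *
            (fluctDefect D.𝒞 H B φ +
              (expNegH (stepOpA (gradCov D.𝒞) H) B φ - 1) * (1 - Complex.exp (-(eval (opB D K) B φ))) -
              (Complex.exp (-(eval (opB D K) B φ)) - 1 + eval (opB D K) B φ)) +
          bprod (L ^ k) (fun B' => expNegH (nextH D H K) B' φ) (U \ B) *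
              bprod (L ^ k) (fun B' => expNegH (-(nextH D H K)) B' φ) (B \ U) *
            fluct D.𝒞 (fun ψ => ∑ Y ∈ ((polys (L ^ k) B).erase B).erase ∅,
              bprod (L ^ k) (fun B' => expNegH H B' ψ - 1) (B \ Y) * K Y ψ) φ)) -
        (∑ B ∈ blockPartIndex D U,
        ((bprod (L ^ k) (fun B' => expNegH (nextH Db H K) B' φ) (U \ B) *
              bprod (L ^ k) (fun B' => expNegH (-(nextH Db H K)) B' φ) (B \ U) - 1) * blockTerm D K B φ +
          bprod (L ^ k) (fun B' => expNegH (nextH Db H K) B' φ) (U \ B) *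
              bprod (L ^ k) (fun B' => expNegH (-(nextH Db H K)) B' φ) (B \ U) *
            (fluctDefect D.𝒞 H B φ +
              (expNegH (stepOpA (gradCov D.𝒞) H) B φ - 1) * (1 - Complex.exp (-(eval (opB D K) B φ))) -
              (Complex.exp (-(eval (opB D K) B φ)) - 1 + eval (opB D K) B φ)) +
          bprod (L ^ k) (fun B' => expNegH (nextH Db H K) B' φ) (U \ B) *
              bprod (L ^ k) (fun B' => expNegH (-(nextH Db H K)) B' φ) (B \ U) *
            fluct D.𝒞 (fun ψ => ∑ Y ∈ ((polys (L ^ k) B).erase B).erase ∅,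
              bprod (L ^ k) (fun B' => expNegH H B' ψ - 1) (B \ Y) * K Y ψ) φ))) :=
    (hS1d D hS _).sub (hS1d D hS _)
  have hF1bd : ContDiff ℝ r₀ (fun φ => (∑ B ∈ blockPartIndex D U,
        ((bprod (L ^ k) (fun B' => expNegH (nextH Db H K) B' φ) (U \ B) *
              bprod (L ^ k) (fun B' => expNegH (-(nextH Db H K)) B' φ) (B \ U) - 1) * blockTerm D K B φ +
          bprod (L ^ k) (fun B' => expNegH (nextH Db H K) B' φ) (U \ B) *
              bprod (L ^ k) (fun B' => expNegH (-(nextH Db H K)) B' φ) (B \ U) *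
            (fluctDefect D.𝒞 H B φ +
              (expNegH (stepOpA (gradCov D.𝒞) H) B φ - 1) * (1 - Complex.exp (-(eval (opB D K) B φ))) -
              (Complex.exp (-(eval (opB D K) B φ)) - 1 + eval (opB D K) B φ)) +
          bprod (L ^ k) (fun B' => expNegH (nextH Db H K) B' φ) (U \ B) *
              bprod (L ^ k) (fun B' => expNegH (-(nextH Db H K)) B' φ) (B \ U) *
            fluct D.𝒞 (fun ψ => ∑ Y ∈ ((polys (L ^ k) B).erase B).erase ∅,
              bprod (L ^ k) (fun B' => expNegH H B' ψ - 1) (B \ Y) * K Y ψ) φ)) -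
        (∑ B ∈ blockPartIndex D U,
        ((bprod (L ^ k) (fun B' => expNegH (nextH Db H K) B' φ) (U \ B) *
              bprod (L ^ k) (fun B' => expNegH (-(nextH Db H K)) B' φ) (B \ U) - 1) * blockTerm Db K B φ +
          bprod (L ^ k) (fun B' => expNegH (nextH Db H K) B' φ) (U \ B) *
              bprod (L ^ k) (fun B' => expNegH (-(nextH Db H K)) B' φ) (B \ U) *
            (fluctDefect Db.𝒞 H B φ +
              (expNegH (stepOpA (gradCov Db.𝒞) H) B φ - 1) * (1 - Complex.exp (-(eval (opB Db K) B φ))) -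
              (Complex.exp (-(eval (opB Db K) B φ)) - 1 + eval (opB Db K) B φ)) +
          bprod (L ^ k) (fun B' => expNegH (nextH Db H K) B' φ) (U \ B) *
              bprod (L ^ k) (fun B' => expNegH (-(nextH Db H K)) B' φ) (B \ U) *
            fluct Db.𝒞 (fun ψ => ∑ Y ∈ ((polys (L ^ k) B).erase B).erase ∅,
              bprod (L ^ k) (fun B' => expNegH H B' ψ - 1) (B \ Y) * K Y ψ) φ))) :=
    (hS1d D hS _).sub (hS1d Db hSb _)
  have hF2ad : ContDiff ℝ r₀ (fun φ => ∑ X ∈ largePartIndex (L ^ k) L U,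
        ((bprod (L ^ k) (fun B => expNegH (nextH D H K) B φ) (U \ X) * bprod (L ^ k) (fun B => expNegH (-(nextH D H K)) B φ) (X \ U) *
            (fluct D.𝒞 (polyP2 (L ^ k) H K X) φ + bprod (L ^ k) (fun B => 1 - expNegH (nextH D H K) B φ) X)) -
          (bprod (L ^ k) (fun B => expNegH (nextH Db H K) B φ) (U \ X) * bprod (L ^ k) (fun B => expNegH (-(nextH Db H K)) B φ) (X \ U) *
            (fluct D.𝒞 (polyP2 (L ^ k) H K X) φ + bprod (L ^ k) (fun B => 1 - expNegH (nextH Db H K) B φ) X)))) := by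
    refine ContDiff.sum fun X hX => ?_
    obtain ⟨hXp, -, -, -⟩ := mem_largePartIndex.1 hX
    exact (hT2d D.𝒞 hS _ X hXp).sub (hT2d D.𝒞 hS _ X hXp)
  have hF2bd : ContDiff ℝ r₀ (fun φ => ∑ X ∈ largePartIndex (L ^ k) L U,
        ((bprod (L ^ k) (fun B => expNegH (nextH Db H K) B φ) (U \ X) * bprod (L ^ k) (fun B => expNegH (-(nextH Db H K)) B φ) (X \ U) *
            (fluct D.𝒞 (polyP2 (L ^ k) H K X) φ + bprod (L ^ k) (fun B => 1 - expNegH (nextH Db H K) B φ) X)) -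
          (bprod (L ^ k) (fun B => expNegH (nextH Db H K) B φ) (U \ X) * bprod (L ^ k) (fun B => expNegH (-(nextH Db H K)) B φ) (X \ U) *
            (fluct Db.𝒞 (polyP2 (L ^ k) H K X) φ + bprod (L ^ k) (fun B => 1 - expNegH (nextH Db H K) B φ) X)))) := by
    refine ContDiff.sum fun X hX => ?_
    obtain ⟨hXp, -, -, -⟩ := mem_largePartIndex.1 hX
    exact (hT2d D.𝒞 hS _ X hXp).sub (hT2d Db.𝒞 hSb _ X hXp)
  have hF3ad : ContDiff ℝ r₀ (fun φ => ∑ X ∈ ((polys (L ^ k) univ).filter (fun X => reblock (L ^ k) (L * L ^ k) X = U)).filter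
          (fun X => ¬ IsConn X),
        ((bprod (L ^ k) (fun B => expNegH (nextH D H K) B φ) (U \ X) * bprod (L ^ k) (fun B => expNegH (-(nextH D H K)) B φ) (X \ U) *
            (fluct D.𝒞 (polyP2 (L ^ k) H K X) φ + bprod (L ^ k) (fun B => 1 - expNegH (nextH D H K) B φ) X)) -
          (bprod (L ^ k) (fun B => expNegH (nextH Db H K) B φ) (U \ X) * bprod (L ^ k) (fun B => expNegH (-(nextH Db H K)) B φ) (X \ U) *
            (fluct D.𝒞 (polyP2 (L ^ k) H K X) φ + bprod (L ^ k) (fun B => 1 - expNegH (nextH Db H K) B φ) X)))) := by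
    refine ContDiff.sum fun X hX => ?_
    have hXp := hUk X (mem_filter.1 hX).1
    exact (hT2d D.𝒞 hS _ X hXp).sub (hT2d D.𝒞 hS _ X hXp)
  have hF3bd : ContDiff ℝ r₀ (fun φ => ∑ X ∈ ((polys (L ^ k) univ).filter (fun X => reblock (L ^ k) (L * L ^ k) X = U)).filter
          (fun X => ¬ IsConn X),
        ((bprod (L ^ k) (fun B => expNegH (nextH Db H K) B φ) (U \ X) * bprod (L ^ k) (fun B => expNegH (-(nextH Db H K)) B φ) (X \ U) *
            (fluct D.𝒞 (polyP2 (L ^ k) H K X) φ + bprod (L ^ k) (fun B => 1 - expNegH (nextH Db H K) B φ) X)) -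
          (bprod (L ^ k) (fun B => expNegH (nextH Db H K) B φ) (U \ X) * bprod (L ^ k) (fun B => expNegH (-(nextH Db H K)) B φ) (X \ U) *
            (fluct Db.𝒞 (polyP2 (L ^ k) H K X) φ + bprod (L ^ k) (fun B => 1 - expNegH (nextH Db H K) B φ) X)))) := by
    refine ContDiff.sum fun X hX => ?_
    have hXp := hUk X (mem_filter.1 hX).1
    exact (hT2d D.𝒞 hS _ X hXp).sub (hT2d Db.𝒞 hSb _ X hXp)
  have hF4ad : ContDiff ℝ r₀ (fun φ => ∑ X ∈ (polys (L ^ k) univ).filter (fun X => reblock (L ^ k) (L * L ^ k) X = U),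
        ∑ X₁ ∈ ((polys (L ^ k) X).erase X).erase ∅,
        ((bprod (L ^ k) (fun B => expNegH (nextH D H K) B φ) (U \ X) * bprod (L ^ k) (fun B => expNegH (-(nextH D H K)) B φ) (X \ U) *
            (bprod (L ^ k) (fun B => 1 - expNegH (nextH D H K) B φ) X₁ * fluct D.𝒞 (polyP2 (L ^ k) H K (X \ X₁)) φ)) -
          (bprod (L ^ k) (fun B => expNegH (nextH Db H K) B φ) (U \ X) * bprod (L ^ k) (fun B => expNegH (-(nextH Db H K)) B φ) (X \ U) *
            (bprod (L ^ k) (fun B => 1 - expNegH (nextH Db H K) B φ) X₁ * fluct D.𝒞 (polyP2 (L ^ k) H K (X \ X₁)) φ)))) := by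
    refine ContDiff.sum fun X hX => ContDiff.sum fun X₁ hX₁ => ?_
    have hXp := hUk X hX
    have hX₁p : X₁ ∈ polys (L ^ k) X := mem_of_mem_erase (mem_of_mem_erase hX₁)
    exact (hT4d D.𝒞 hS _ X hXp X₁ hX₁p).sub (hT4d D.𝒞 hS _ X hXp X₁ hX₁p)
  have hF4bd : ContDiff ℝ r₀ (fun φ => ∑ X ∈ (polys (L ^ k) univ).filter (fun X => reblock (L ^ k) (L * L ^ k) X = U),
        ∑ X₁ ∈ ((polys (L ^ k) X).erase X).erase ∅,
        ((bprod (L ^ k) (fun B => expNegH (nextH Db H K) B φ) (U \ X) * bprod (L ^ k) (fun B => expNegH (-(nextH Db H K)) B φ) (X \ U) *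
            (bprod (L ^ k) (fun B => 1 - expNegH (nextH Db H K) B φ) X₁ * fluct D.𝒞 (polyP2 (L ^ k) H K (X \ X₁)) φ)) -
          (bprod (L ^ k) (fun B => expNegH (nextH Db H K) B φ) (U \ X) * bprod (L ^ k) (fun B => expNegH (-(nextH Db H K)) B φ) (X \ U) *
            (bprod (L ^ k) (fun B => 1 - expNegH (nextH Db H K) B φ) X₁ * fluct Db.𝒞 (polyP2 (L ^ k) H K (X \ X₁)) φ)))) := by
    refine ContDiff.sum fun X hX => ContDiff.sum fun X₁ hX₁ => ?_
    have hXp := hUk X hX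
    have hX₁p : X₁ ∈ polys (L ^ k) X := mem_of_mem_erase (mem_of_mem_erase hX₁)
    exact (hT4d D.𝒞 hS _ X hXp X₁ hX₁p).sub (hT4d Db.𝒞 hSb _ X hXp X₁ hX₁p)
  -- the sum of the nine bounds
  have s1 := h0.add h1a hF0d hF1ad
  have s2 := s1.add h1b (hF0d.add hF1ad) hF1bd
  have s3 := s2.add h2a ((hF0d.add hF1ad).add hF1bd) hF2ad
  have s4 := s3.add h2b (((hF0d.add hF1ad).add hF1bd).add hF2ad) hF2bd
  have s5 := s4.add h3a ((((hF0d.add hF1ad).add hF1bd).add hF2ad).add hF2bd) hF3ad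
  have s6 := s5.add h3b (((((hF0d.add hF1ad).add hF1bd).add hF2ad).add hF2bd).add hF3ad) hF3bd
  have s7 := s6.add h4a ((((((hF0d.add hF1ad).add hF1bd).add hF2ad).add hF2bd).add hF3ad).add hF3bd) hF4ad
  have s8 := s7.add h4b (((((((hF0d.add hF1ad).add hF1bd).add hF2ad).add hF2bd).add hF3ad).add hF3bd).add hF4ad) hF4bd
  -- the decomposition of `S_a(H,K)(U)` and of `S_b(H,K)(U)`
  have hdec := nextKStep_eq_blockPart_add_remainders_abkm_of_stepKernelBounds (p := p) (r₀ := r₀) (A := A) hd hLodd hL hM hkN hp hpR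
    hMord hB hδ₀ hδ₁ hh hh0 hA D hDs hDL hS hB₀ hc₀ hH hC hK hKfac hK0 hKd hKloc hUne
  have hdec' := nextKStep_eq_blockPart_add_remainders_abkm_of_stepKernelBounds (p := p) (r₀ := r₀) (A := A) hd hLodd hL hM hkN hp hpR
    hMord hB hδ₀ hδ₁ hh hh0 hA Db hDbs hDbL hSb hB₀b hc₀b hH hC hK hKfac hK0 hKd hKloc hUne
  have hbpi : blockPartIndex Db U = blockPartIndex D U := by
    unfold blockPartIndex; rw [hDbs, hDbL, hDs, hDL]
  have hfun : (fun φ => nextKStep D H K U φ - nextKStep Db H K U φ) =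
      (fun φ => blockPart D K U φ - blockPart Db K U φ) + (fun φ => (∑ B ∈ blockPartIndex D U,
        ((bprod (L ^ k) (fun B' => expNegH (nextH D H K) B' φ) (U \ B) *
              bprod (L ^ k) (fun B' => expNegH (-(nextH D H K)) B' φ) (B \ U) - 1) * blockTerm D K B φ +
          bprod (L ^ k) (fun B' => expNegH (nextH D H K) B' φ) (U \ B) *
              bprod (L ^ k) (fun B' => expNegH (-(nextH D H K)) B' φ) (B \ U) *
            (fluctDefect D.𝒞 H B φ +
              (expNegH (stepOpA (gradCov D.𝒞) H) B φ - 1) * (1 - Complex.exp (-(eval (opB D K) B φ))) -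
              (Complex.exp (-(eval (opB D K) B φ)) - 1 + eval (opB D K) B φ)) +
          bprod (L ^ k) (fun B' => expNegH (nextH D H K) B' φ) (U \ B) *
              bprod (L ^ k) (fun B' => expNegH (-(nextH D H K)) B' φ) (B \ U) *
            fluct D.𝒞 (fun ψ => ∑ Y ∈ ((polys (L ^ k) B).erase B).erase ∅,
              bprod (L ^ k) (fun B' => expNegH H B' ψ - 1) (B \ Y) * K Y ψ) φ)) -
        (∑ B ∈ blockPartIndex D U,
        ((bprod (L ^ k) (fun B' => expNegH (nextH Db H K) B' φ) (U \ B) *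
              bprod (L ^ k) (fun B' => expNegH (-(nextH Db H K)) B' φ) (B \ U) - 1) * blockTerm D K B φ +
          bprod (L ^ k) (fun B' => expNegH (nextH Db H K) B' φ) (U \ B) *
              bprod (L ^ k) (fun B' => expNegH (-(nextH Db H K)) B' φ) (B \ U) *
            (fluctDefect D.𝒞 H B φ +
              (expNegH (stepOpA (gradCov D.𝒞) H) B φ - 1) * (1 - Complex.exp (-(eval (opB D K) B φ))) -
              (Complex.exp (-(eval (opB D K) B φ)) - 1 + eval (opB D K) B φ)) +
          bprod (L ^ k) (fun B' => expNegH (nextH Db H K) B' φ) (U \ B) *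
              bprod (L ^ k) (fun B' => expNegH (-(nextH Db H K)) B' φ) (B \ U) *
            fluct D.𝒞 (fun ψ => ∑ Y ∈ ((polys (L ^ k) B).erase B).erase ∅,
              bprod (L ^ k) (fun B' => expNegH H B' ψ - 1) (B \ Y) * K Y ψ) φ))) + (fun φ => (∑ B ∈ blockPartIndex D U,
        ((bprod (L ^ k) (fun B' => expNegH (nextH Db H K) B' φ) (U \ B) *
              bprod (L ^ k) (fun B' => expNegH (-(nextH Db H K)) B' φ) (B \ U) - 1) * blockTerm D K B φ +
          bprod (L ^ k) (fun B' => expNegH (nextH Db H K) B' φ) (U \ B) *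
              bprod (L ^ k) (fun B' => expNegH (-(nextH Db H K)) B' φ) (B \ U) *
            (fluctDefect D.𝒞 H B φ +
              (expNegH (stepOpA (gradCov D.𝒞) H) B φ - 1) * (1 - Complex.exp (-(eval (opB D K) B φ))) -
              (Complex.exp (-(eval (opB D K) B φ)) - 1 + eval (opB D K) B φ)) +
          bprod (L ^ k) (fun B' => expNegH (nextH Db H K) B' φ) (U \ B) *
              bprod (L ^ k) (fun B' => expNegH (-(nextH Db H K)) B' φ) (B \ U) *
            fluct D.𝒞 (fun ψ => ∑ Y ∈ ((polys (L ^ k) B).erase B).erase ∅,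
              bprod (L ^ k) (fun B' => expNegH H B' ψ - 1) (B \ Y) * K Y ψ) φ)) -
        (∑ B ∈ blockPartIndex D U,
        ((bprod (L ^ k) (fun B' => expNegH (nextH Db H K) B' φ) (U \ B) *
              bprod (L ^ k) (fun B' => expNegH (-(nextH Db H K)) B' φ) (B \ U) - 1) * blockTerm Db K B φ +
          bprod (L ^ k) (fun B' => expNegH (nextH Db H K) B' φ) (U \ B) *
              bprod (L ^ k) (fun B' => expNegH (-(nextH Db H K)) B' φ) (B \ U) *
            (fluctDefect Db.𝒞 H B φ +
              (expNegH (stepOpA (gradCov Db.𝒞) H) B φ - 1) * (1 - Complex.exp (-(eval (opB Db K) B φ))) -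
              (Complex.exp (-(eval (opB Db K) B φ)) - 1 + eval (opB Db K) B φ)) +
          bprod (L ^ k) (fun B' => expNegH (nextH Db H K) B' φ) (U \ B) *
              bprod (L ^ k) (fun B' => expNegH (-(nextH Db H K)) B' φ) (B \ U) *
            fluct Db.𝒞 (fun ψ => ∑ Y ∈ ((polys (L ^ k) B).erase B).erase ∅,
              bprod (L ^ k) (fun B' => expNegH H B' ψ - 1) (B \ Y) * K Y ψ) φ))) + (fun φ => ∑ X ∈ largePartIndex (L ^ k) L U,
        ((bprod (L ^ k) (fun B => expNegH (nextH D H K) B φ) (U \ X) * bprod (L ^ k) (fun B => expNegH (-(nextH D H K)) B φ) (X \ U) *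
            (fluct D.𝒞 (polyP2 (L ^ k) H K X) φ + bprod (L ^ k) (fun B => 1 - expNegH (nextH D H K) B φ) X)) -
          (bprod (L ^ k) (fun B => expNegH (nextH Db H K) B φ) (U \ X) * bprod (L ^ k) (fun B => expNegH (-(nextH Db H K)) B φ) (X \ U) *
            (fluct D.𝒞 (polyP2 (L ^ k) H K X) φ + bprod (L ^ k) (fun B => 1 - expNegH (nextH Db H K) B φ) X)))) + (fun φ => ∑ X ∈ largePartIndex (L ^ k) L U,
        ((bprod (L ^ k) (fun B => expNegH (nextH Db H K) B φ) (U \ X) * bprod (L ^ k) (fun B => expNegH (-(nextH Db H K)) B φ) (X \ U) *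
            (fluct D.𝒞 (polyP2 (L ^ k) H K X) φ + bprod (L ^ k) (fun B => 1 - expNegH (nextH Db H K) B φ) X)) -
          (bprod (L ^ k) (fun B => expNegH (nextH Db H K) B φ) (U \ X) * bprod (L ^ k) (fun B => expNegH (-(nextH Db H K)) B φ) (X \ U) *
            (fluct Db.𝒞 (polyP2 (L ^ k) H K X) φ + bprod (L ^ k) (fun B => 1 - expNegH (nextH Db H K) B φ) X)))) + (fun φ => ∑ X ∈ ((polys (L ^ k) univ).filter (fun X => reblock (L ^ k) (L * L ^ k) X = U)).filter
          (fun X => ¬ IsConn X),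
        ((bprod (L ^ k) (fun B => expNegH (nextH D H K) B φ) (U \ X) * bprod (L ^ k) (fun B => expNegH (-(nextH D H K)) B φ) (X \ U) *
            (fluct D.𝒞 (polyP2 (L ^ k) H K X) φ + bprod (L ^ k) (fun B => 1 - expNegH (nextH D H K) B φ) X)) -
          (bprod (L ^ k) (fun B => expNegH (nextH Db H K) B φ) (U \ X) * bprod (L ^ k) (fun B => expNegH (-(nextH Db H K)) B φ) (X \ U) *
            (fluct D.𝒞 (polyP2 (L ^ k) H K X) φ + bprod (L ^ k) (fun B => 1 - expNegH (nextH Db H K) B φ) X)))) + (fun φ => ∑ X ∈ ((polys (L ^ k) univ).filter (fun X => reblock (L ^ k) (L * L ^ k) X = U)).filter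
          (fun X => ¬ IsConn X),
        ((bprod (L ^ k) (fun B => expNegH (nextH Db H K) B φ) (U \ X) * bprod (L ^ k) (fun B => expNegH (-(nextH Db H K)) B φ) (X \ U) *
            (fluct D.𝒞 (polyP2 (L ^ k) H K X) φ + bprod (L ^ k) (fun B => 1 - expNegH (nextH Db H K) B φ) X)) -
          (bprod (L ^ k) (fun B => expNegH (nextH Db H K) B φ) (U \ X) * bprod (L ^ k) (fun B => expNegH (-(nextH Db H K)) B φ) (X \ U) *
            (fluct Db.𝒞 (polyP2 (L ^ k) H K X) φ + bprod (L ^ k) (fun B => 1 - expNegH (nextH Db H K) B φ) X)))) + (fun φ => ∑ X ∈ (polys (L ^ k) univ).filter (fun X => reblock (L ^ k) (L * L ^ k) X = U),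
        ∑ X₁ ∈ ((polys (L ^ k) X).erase X).erase ∅,
        ((bprod (L ^ k) (fun B => expNegH (nextH D H K) B φ) (U \ X) * bprod (L ^ k) (fun B => expNegH (-(nextH D H K)) B φ) (X \ U) *
            (bprod (L ^ k) (fun B => 1 - expNegH (nextH D H K) B φ) X₁ * fluct D.𝒞 (polyP2 (L ^ k) H K (X \ X₁)) φ)) -
          (bprod (L ^ k) (fun B => expNegH (nextH Db H K) B φ) (U \ X) * bprod (L ^ k) (fun B => expNegH (-(nextH Db H K)) B φ) (X \ U) *
            (bprod (L ^ k) (fun B => 1 - expNegH (nextH Db H K) B φ) X₁ * fluct D.𝒞 (polyP2 (L ^ k) H K (X \ X₁)) φ)))) + (fun φ => ∑ X ∈ (polys (L ^ k) univ).filter (fun X => reblock (L ^ k) (L * L ^ k) X = U),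
        ∑ X₁ ∈ ((polys (L ^ k) X).erase X).erase ∅,
        ((bprod (L ^ k) (fun B => expNegH (nextH Db H K) B φ) (U \ X) * bprod (L ^ k) (fun B => expNegH (-(nextH Db H K)) B φ) (X \ U) *
            (bprod (L ^ k) (fun B => 1 - expNegH (nextH Db H K) B φ) X₁ * fluct D.𝒞 (polyP2 (L ^ k) H K (X \ X₁)) φ)) -
          (bprod (L ^ k) (fun B => expNegH (nextH Db H K) B φ) (U \ X) * bprod (L ^ k) (fun B => expNegH (-(nextH Db H K)) B φ) (X \ U) *
            (bprod (L ^ k) (fun B => 1 - expNegH (nextH Db H K) B φ) X₁ * fluct Db.𝒞 (polyP2 (L ^ k) H K (X \ X₁)) φ)))) := by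
    funext ψ
    simp only [Pi.add_apply]
    rw [hdec ψ, hdec' ψ, hbpi]
    simp only [sum_sub_distrib]
    ring
  rw [hfun]
  exact s8

end Literature.MathematicalPhysics.StatisticalMechanics.GradientRG

end
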